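import Summits.QuantumAdvantage.QuantumAdvantage.Theorems.CubicForrelationNearExactIsExactFourModSixSecondSplitBudget
import Summits.QuantumAdvantage.QuantumAdvantage.Theorems.CubicForrelationNearExactIsExactSixteenSplitB

/-!
# Crux `CubicForrelation.NearExactIsExact` (stmt-QuantumAdvantage-14043) — `n = 6r+4`, TWO-SIDED, second boundary: split configuration (sB)
  is empty (`r ≥ 3`)

Certificate seat `b2b-cforr-cert` (gen 8).  HONEST FRAMING: a theorem uniform in `r` about cubic Boolean pairs on `6r+4` bits (the tree's
`n = 16` file `…SixteenSplitB.lean` in general `r`); one of the three split configurations of `f2_split_trichotomy`; NOT summit progress.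

Configuration (sB): parity `d₀` affine non-constant (support `L`, complement `H`), `A = ∅` (`d₁ = 0` on `H`), `B' := H ∩ {d₂ = 1}` an
`(n−5)`-flat inside `H` (`d₂` quartic), `C' = ∅`, budget identity and pointwise equality.  The residual `τ = u − 2^r s` is `(−1)^{d₁}` on `L`,
`±4` on `B'`, `0` on `H ∖ B'`.  `L`-piece: `V_L` are periods up to sign (since `d₁ ≡ 0` on `H`) ⇒ `Σ|·̂| ≤ N`; `B'`-piece `ε = τ/4`: FOUR
directions in `V_L ∖ V_{B'}` localise the 6-flat sums (`16 ∣ Σ₆ u`, Ax for `f`) to `4·Σ_{2-flat} ε ∈ 16ℤ`, so `ε` is multiplicative on 2-flats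
of `B'`, i.e. `V_{B'}` are periods up to sign ⇒ `Σ|·̂| ≤ N`.  Total `≤ 5N` against the pairing `2^{2r+1}N ≥ 128N`.

References: J. Ax (1964) / R. J. McEliece (1972); MacWilliams–Sloane (1977) Ch. 13–15; R. O'Donnell (2014) §3.3.  Everything below is proved
from Mathlib and the tree; axioms are the standard three.
-/

set_option linter.dupNamespace false -- D-0017: single-problem summit ⇒ `QuantumAdvantage.QuantumAdvantage` by design

noncomputable section

namespace Summit.QuantumAdvantage.QuantumAdvantage.Theorems.CubicForrelation.NearExactIsExact

open Finset
open Literature.Computability.QuantumComplexity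
open Literature.Computability.QuantumComplexity.BuzetChailloux (bxor zeroVec bxor_bxor_cancel_left bxor_zeroVec zeroVec_bxor bxor_comm
  bxor_self)
open Literature.Computability.QuantumComplexity.DerivativeWalsh (W)

/-- **Configuration (sB) is empty (`r ≥ 3`).**  For cubic `f, g : 𝔽₂^{(3r+2)+(3r+2)} → 𝔽₂` with `W_g = 2^{2r+2}u`, a non-constant parity
`[u odd]`, the budget identity `2^{8r+5}(1−Φ) = 2^{6r+4}`, the pointwise budget identity of `f2_split_trichotomy`, and digit sets `A = ∅`,
`#B' = N/32`, `C' = ∅`: contradiction.  Uniform in `r`; NOT summit progress. [this work] -/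
theorem f2_splitB_false (r : ℕ) (hr : 3 ≤ r) (f g : (Fin ((3 * r + 2) + (3 * r + 2)) → Bool) → Bool) (hf : IsDegLeFun 3 f)
    (hg : IsDegLeFun 3 g) (u : (Fin ((3 * r + 2) + (3 * r + 2)) → Bool) → ℤ)
    (hu : ∀ x, W (fun y => signOf (g y)) x = (2 : ℝ) ^ (2 * r + 2) * (u x : ℝ))
    (hodd : ∃ x, Odd (u x)) (heven : ∃ x, ¬ Odd (u x))
    (hTeq : (2 : ℝ) ^ (8 * r + 5) * (1 - forrelation f g) = 2 ^ (6 * r + 4))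
    (hpt : ∀ x, (u x - 2 ^ r * sZ (f x)) ^ 2 = (if Odd (u x) then 1 else 0) + 4 * (if ¬ Odd (u x) ∧ Odd (u x / 2) then 1 else 0)
      + 16 * (if ¬ Odd (u x) ∧ ¬ Odd (u x / 2) ∧ Odd (u x / 2 / 2) then 1 else 0)
      + 8 * (if Odd (u x) ∧ ¬ (Odd (u x / 2) ↔ Odd (u x / 2 / 2)) then 1 else 0))
    (hA0 : #(univ.filter fun x : Fin ((3 * r + 2) + (3 * r + 2)) → Bool => ¬ Odd (u x) ∧ Odd (u x / 2)) = 0)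
    (hBc : #(univ.filter fun x : Fin ((3 * r + 2) + (3 * r + 2)) → Bool =>
      ¬ Odd (u x) ∧ ¬ Odd (u x / 2) ∧ Odd (u x / 2 / 2)) = 2 ^ (6 * r - 1))
    (hC0 : #(univ.filter fun x : Fin ((3 * r + 2) + (3 * r + 2)) → Bool => Odd (u x) ∧ ¬ (Odd (u x / 2) ↔ Odd (u x / 2 / 2))) = 0) :
    False := by
  classical
  have hd0 : IsDegLeFun 1 (fun x => decide (Odd (u x))) := f2_digitZero r g u hg hu
  have hd1 : IsDegLeFun 2 (fun x => decide (Odd (u x / 2))) := f2_digitOne r g u hg hu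
  have hd2 : IsDegLeFun 4 (fun x => decide (Odd (u x / 2 / 2))) := f2_digitTwo r g u hg hu
  have hLc : #(univ.filter fun x : Fin ((3 * r + 2) + (3 * r + 2)) → Bool => Odd (u x)) = 2 ^ (6 * r + 3) :=
    f2_card_odd_of_split r g u hg hu hodd heven
  obtain ⟨k, rfl⟩ : ∃ k, r = k + 3 := ⟨r - 3, by omega⟩
  rw [show 6 * (k + 3) - 1 = 6 * k + 17 by omega] at hBc
  have hA : ∀ x, ¬ Odd (u x) → ¬ Odd (u x / 2) := by
    intro x hx h2
    exact filter_eq_empty_iff.1 (card_eq_zero.1 hA0) (mem_univ x) ⟨hx, h2⟩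
  have hC : ∀ x, Odd (u x) → (Odd (u x / 2) ↔ Odd (u x / 2 / 2)) := by
    intro x hx
    by_contra h
    exact filter_eq_empty_iff.1 (card_eq_zero.1 hC0) (mem_univ x) ⟨hx, h⟩
  set B := univ.filter (fun x : Fin ((3 * (k + 3) + 2) + (3 * (k + 3) + 2)) → Bool =>
    ¬ Odd (u x) ∧ ¬ Odd (u x / 2) ∧ Odd (u x / 2 / 2)) with hBdef
  have hmemB : ∀ x, x ∈ B ↔ ¬ Odd (u x) ∧ ¬ Odd (u x / 2) ∧ Odd (u x / 2 / 2) := fun x => by simp [hBdef]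
  have h4c : ∀ x, (4 : ℤ) ∣ 2 ^ (k + 3) * sZ (f x) := fun x => ⟨2 ^ (k + 1) * sZ (f x), by ring⟩
  have hpow4 : (2 : ℤ) ^ (k + 3) = 4 * 2 ^ (k + 1) := by ring
  -- the residual
  have hτL : ∀ x, Odd (u x) → u x - 2 ^ (k + 3) * sZ (f x) = sZ (decide (Odd (u x / 2))) := by
    intro x hx
    have h := hpt x
    rw [if_pos hx, if_neg (fun h => h.1 hx), if_neg (fun h => h.1 hx), if_neg (fun h => h.2 (hC x hx))] at h
    have h1 : (u x - 2 ^ (k + 3) * sZ (f x)) * (u x - 2 ^ (k + 3) * sZ (f x)) = 1 := by rw [← pow_two]; linarith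
    exact z2_tau_one (h4c x) (mul_self_eq_one_iff.1 h1)
  have hτB : ∀ x, x ∈ B → (u x - 2 ^ (k + 3) * sZ (f x)) ^ 2 = 16 := by
    intro x hxB
    have hx := (hmemB x).1 hxB
    have h := hpt x
    rw [if_neg hx.1, if_neg (fun h => hx.2.1 h.2), if_pos hx, if_neg (fun h => hx.1 h.1)] at h
    linarith
  have hτ0 : ∀ x, ¬ Odd (u x) → x ∉ B → u x - 2 ^ (k + 3) * sZ (f x) = 0 := by
    intro x hx hxB
    have h := hpt x
    rw [if_neg hx, if_neg (fun h => hA x hx h.2), if_neg (fun h => hxB ((hmemB x).2 h)), if_neg (fun h => hx h.1)] at h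
    have h' : (u x - 2 ^ (k + 3) * sZ (f x)) ^ 2 = 0 := by linarith
    exact (pow_eq_zero_iff two_ne_zero).1 h'
  -- `B` is an `(n−5)`-flat
  have hdegB : IsDegLeFun (4 + 1) (fun x => (decide (Odd (u x)) ^^ true) && decide (Odd (u x / 2 / 2))) :=
    bb_deg_and (tb_isDegLeFun_xor_const hd0 true) hd2 (by norm_num)
  have hsetB : (univ.filter fun x : Fin ((3 * (k + 3) + 2) + (3 * (k + 3) + 2)) → Bool =>
      ((decide (Odd (u x)) ^^ true) && decide (Odd (u x / 2 / 2))) = true) = B := by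
    rw [hBdef]
    apply filter_congr
    intro x _
    simp only [Bool.xor_true, Bool.and_eq_true, Bool.not_eq_true', decide_eq_false_iff_not, decide_eq_true_eq]
    exact ⟨fun h => ⟨h.1, hA x h.1, h.2⟩, fun h => ⟨h.1, h.2.2⟩⟩
  have hmwB := mw_flat_of_minweight 4 _ hdegB (by rw [hsetB, hBc]; ring)
  rw [hsetB] at hmwB
  obtain ⟨h0B, haddB, hcardVB, hcosetB⟩ := hmwB
  set VB := univ.filter (fun a : Fin ((3 * (k + 3) + 2) + (3 * (k + 3) + 2)) → Bool => ∀ x,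
    ((decide (Odd (u (bxor x a))) ^^ true) && decide (Odd (u (bxor x a) / 2 / 2))) =
      ((decide (Odd (u x)) ^^ true) && decide (Odd (u x / 2 / 2)))) with hVB
  rw [hBc] at hcardVB
  have hBpos : 0 < #B := by rw [hBc]; exact Nat.two_pow_pos _
  obtain ⟨xB, hxB⟩ : B.Nonempty := card_pos.1 hBpos
  have hSB : B = VB.image (bxor xB) := hcosetB xB (by
    have h := (hmemB xB).1 hxB
    simp [h.1, h.2.2])
  have hPVB : ∀ x, x ∈ B → ∀ a ∈ VB, bxor x a ∈ B := fun x hx a ha => fl1_coset_vadd haddB hSB hx ha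
  -- `L` : periods of `d₀`
  have hfiltL : (univ.filter fun x : Fin ((3 * (k + 3) + 2) + (3 * (k + 3) + 2)) → Bool => decide (Odd (u x)) = true) =
      univ.filter fun x => Odd (u x) := filter_congr fun x _ => by simp
  have hd0' : IsDegLeFun (0 + 1) (fun x => decide (Odd (u x))) := hd0
  have hmwL := mw_flat_of_minweight 0 _ hd0' (by rw [hfiltL, hLc]; ring)
  obtain ⟨h0L, haddL, hcardVL, -⟩ := hmwL
  rw [hfiltL, hLc] at hcardVL
  set VL := univ.filter (fun a : Fin ((3 * (k + 3) + 2) + (3 * (k + 3) + 2)) → Bool => ∀ x,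
    decide (Odd (u (bxor x a))) = decide (Odd (u x))) with hVL
  have hperL : ∀ a ∈ VL, ∀ x, decide (Odd (u (bxor x a))) = decide (Odd (u x)) := fun a ha => (mem_filter.1 ha).2
  -- `V_B ⊆ V_L`
  have hVBL : ∀ a ∈ VB, ∀ x, decide (Odd (u (bxor x a))) = decide (Odd (u x)) := by
    intro a ha x
    have hxa : bxor xB a ∈ B := hPVB xB hxB a ha
    have hc := tc_const_of_deg_zero (stub_derivDegree ((3 * (k + 3) + 2) + (3 * (k + 3) + 2)) 0 (fun x => decide (Odd (u x))) a hd0)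
      x xB
    have e1 : decide (Odd (u xB)) = false := decide_eq_false ((hmemB xB).1 hxB).1
    have e2 : decide (Odd (u (bxor xB a))) = false := decide_eq_false ((hmemB _).1 hxa).1
    simp only [e1, e2] at hc
    revert hc; cases decide (Odd (u (bxor x a))) <;> cases decide (Odd (u x)) <;> decide
  -- staying in `H` along `V_L`
  have hH_of : ∀ p, ¬ Odd (u p) → ∀ t ∈ VL, ¬ Odd (u (bxor p t)) := by
    intro p hp t ht hodd'
    have := hperL t ht p
    rw [decide_eq_false hp] at this
    exact absurd hodd' (by simpa using this)
  have hz : ∀ p ∈ B, ∀ t ∈ VL, t ∉ VB → u (bxor p t) - 2 ^ (k + 3) * sZ (f (bxor p t)) = 0 :=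
    fun p hp t ht htB => hτ0 _ (hH_of p ((hmemB p).1 hp).1 t ht) (fl1_coset_out h0B haddB hSB hp htB)
  -- the `B`-piece `ε = u/4 − 2^{r-2} s`
  set eB : (Fin ((3 * (k + 3) + 2) + (3 * (k + 3) + 2)) → Bool) → ℤ := fun x => u x / 4 - 2 ^ (k + 1) * sZ (f x) with heBdef
  have hFe : ∀ p ∈ B, u p - 2 ^ (k + 3) * sZ (f p) = 4 * eB p := by
    intro p hp
    obtain ⟨hp0, hp1, -⟩ := (hmemB p).1 hp
    obtain ⟨m₁, hm₁⟩ := Int.not_odd_iff_even.1 hp0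
    have hk2 : u p / 2 = m₁ := by rw [hm₁, show m₁ + m₁ = 2 * m₁ by ring, Int.mul_ediv_cancel_left m₁ (by norm_num : (2 : ℤ) ≠ 0)]
    rw [hk2] at hp1
    obtain ⟨m, hm⟩ := Int.not_odd_iff_even.1 hp1
    simp only [eB]
    rw [hm₁, hm, show m + m + (m + m) = 4 * m by ring, Int.mul_ediv_cancel_left m (by norm_num : (4 : ℤ) ≠ 0), hpow4]
    ring
  have heB : ∀ p ∈ B, eB p = 1 ∨ eB p = -1 := by
    intro p hp
    have h16 := hτB p hp
    rw [hFe p hp] at h16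
    have h1 : eB p * eB p = 1 := by nlinarith
    exact mul_self_eq_one_iff.1 h1
  -- four directions in `V_L` transversal to `V_B`
  obtain ⟨t₁, ht₁L, t₂, ht₂L, t₃, ht₃L, t₄, ht₄L, n1, n2, n21, n3, n31, n32, n321, n4, n41, n42, n421, n43, n431, n432, n4321⟩ :=
    st4_dirs4 VL VB (by
      rw [hcardVB, hcardVL]
      have e : (2 : ℕ) ^ (6 * (k + 3) + 3) = 16 * 2 ^ (6 * k + 17) := by ring
      rw [e]; have hX : 0 < 2 ^ (6 * k + 17) := Nat.two_pow_pos _; linarith)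
  -- 2-flat multiplicativity of `ε` on `B`
  have hmul : ∀ x ∈ B, ∀ a ∈ VB, ∀ b ∈ VB, eB (bxor (bxor x b) a) * eB x = eB (bxor x a) * eB (bxor x b) := by
    intro x hx a ha b hb
    have hin : ∀ ε : Fin 2 → Bool, (fun j => x j ^^ decide (Odd #(univ.filter fun i =>
        ε i && (![a, b] : Fin 2 → Fin ((3 * (k + 3) + 2) + (3 * (k + 3) + 2)) → Bool) i j))) ∈ B :=
      fun ε => st4_mem_flatPt2 VB h0B (· ∈ B) hPVB hx ![a, b] (fun i => by fin_cases i <;> assumption) ε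
    have h16 := fs_flat_sum_dvd (e := 4) g u hg hu x ![t₁, t₂, t₃, t₄, a, b] (by omega)
    obtain ⟨zf, hzf⟩ := sl_sum_sZ_flat f hf x ![t₁, t₂, t₃, t₄, a, b]
    have hzf' : ∑ ε : Fin 6 → Bool, 2 ^ (k + 3) * sZ (f (fun j => x j ^^ decide (Odd #(univ.filter fun i =>
          ε i && (![t₁, t₂, t₃, t₄, a, b] : Fin 6 → Fin ((3 * (k + 3) + 2) + (3 * (k + 3) + 2)) → Bool) i j)))) =
        16 * (2 ^ (k + 1) * zf) := by
      rw [← mul_sum, hzf]; norm_num; ring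
    have h16n : (16 : ℤ) ∣ ∑ ε : Fin 6 → Bool, u (fun j => x j ^^ decide (Odd #(univ.filter fun i =>
          ε i && (![t₁, t₂, t₃, t₄, a, b] : Fin 6 → Fin ((3 * (k + 3) + 2) + (3 * (k + 3) + 2)) → Bool) i j))) := by
      have e16 : (2 : ℤ) ^ 4 = 16 := by norm_num
      rw [e16] at h16; exact h16
    have h16' : (16 : ℤ) ∣ ∑ ε : Fin 6 → Bool, (u (fun j => x j ^^ decide (Odd #(univ.filter fun i =>
          ε i && (![t₁, t₂, t₃, t₄, a, b] : Fin 6 → Fin ((3 * (k + 3) + 2) + (3 * (k + 3) + 2)) → Bool) i j))) -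
        2 ^ (k + 3) * sZ (f (fun j => x j ^^ decide (Odd #(univ.filter fun i =>
          ε i && (![t₁, t₂, t₃, t₄, a, b] : Fin 6 → Fin ((3 * (k + 3) + 2) + (3 * (k + 3) + 2)) → Bool) i j))))) := by
      rw [sum_sub_distrib, hzf']
      exact dvd_sub h16n (Dvd.intro _ rfl)
    have hv : ∀ ε : Fin 2 → Bool, ∀ w ∈ VL, w ∉ VB →
        u (bxor (fun j => x j ^^ decide (Odd #(univ.filter fun i =>
          ε i && (![a, b] : Fin 2 → Fin ((3 * (k + 3) + 2) + (3 * (k + 3) + 2)) → Bool) i j))) w) -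
        2 ^ (k + 3) * sZ (f (bxor (fun j => x j ^^ decide (Odd #(univ.filter fun i =>
          ε i && (![a, b] : Fin 2 → Fin ((3 * (k + 3) + 2) + (3 * (k + 3) + 2)) → Bool) i j))) w)) = 0 :=
      fun ε w hw hwB => hz _ (hin ε) w hw hwB
    have hL2 : ∀ {p q : Fin ((3 * (k + 3) + 2) + (3 * (k + 3) + 2)) → Bool}, p ∈ VL → q ∈ VL → bxor p q ∈ VL :=
      fun hp hq => haddL _ hp _ hq
    have key := st4_loc4 (fun y => u y - 2 ^ (k + 3) * sZ (f y)) x t₁ t₂ t₃ t₄ ![a, b]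
      (fun ε => hv ε t₁ ht₁L n1) (fun ε => hv ε t₂ ht₂L n2)
      (fun ε => by rw [iw_bxor_assoc]; exact hv ε _ (hL2 ht₂L ht₁L) n21)
      (fun ε => hv ε t₃ ht₃L n3)
      (fun ε => by rw [iw_bxor_assoc]; exact hv ε _ (hL2 ht₃L ht₁L) n31)
      (fun ε => by rw [iw_bxor_assoc]; exact hv ε _ (hL2 ht₃L ht₂L) n32)
      (fun ε => by rw [iw_bxor_assoc, iw_bxor_assoc]; exact hv ε _ (hL2 ht₃L (hL2 ht₂L ht₁L)) n321)
      (fun ε => hv ε t₄ ht₄L n4)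
      (fun ε => by rw [iw_bxor_assoc]; exact hv ε _ (hL2 ht₄L ht₁L) n41)
      (fun ε => by rw [iw_bxor_assoc]; exact hv ε _ (hL2 ht₄L ht₂L) n42)
      (fun ε => by rw [iw_bxor_assoc, iw_bxor_assoc]; exact hv ε _ (hL2 ht₄L (hL2 ht₂L ht₁L)) n421)
      (fun ε => by rw [iw_bxor_assoc]; exact hv ε _ (hL2 ht₄L ht₃L) n43)
      (fun ε => by rw [iw_bxor_assoc, iw_bxor_assoc]; exact hv ε _ (hL2 ht₄L (hL2 ht₃L ht₁L)) n431)
      (fun ε => by rw [iw_bxor_assoc, iw_bxor_assoc]; exact hv ε _ (hL2 ht₄L (hL2 ht₃L ht₂L)) n432)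
      (fun ε => by rw [iw_bxor_assoc, iw_bxor_assoc, iw_bxor_assoc]; exact hv ε _ (hL2 ht₄L (hL2 ht₃L (hL2 ht₂L ht₁L))) n4321)
    beta_reduce at key
    rw [key] at h16'
    have e2 := st4_sum2 (fun y => u y - 2 ^ (k + 3) * sZ (f y)) x a b
    beta_reduce at e2
    rw [e2, hFe _ hx, hFe _ (hPVB _ hx _ ha), hFe _ (hPVB _ hx _ hb), hFe _ (hPVB _ (hPVB _ hx _ hb) _ ha)] at h16'
    have h4 : (4 : ℤ) ∣ eB x + eB (bxor x a) + eB (bxor x b) + eB (bxor (bxor x b) a) := by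
      obtain ⟨m, hm⟩ := h16'
      exact ⟨m, by linarith⟩
    exact fl_signs_of_four_dvd (heB _ hx) (heB _ (hPVB _ hx _ ha)) (heB _ (hPVB _ hx _ hb))
      (heB _ (hPVB _ (hPVB _ hx _ hb) _ ha)) h4
  -- periods up to sign of `ε1_B`
  set AB : (Fin ((3 * (k + 3) + 2) + (3 * (k + 3) + 2)) → Bool) → ℝ := fun x => if x ∈ B then (eB x : ℝ) else 0 with hAB
  have hperB : ∀ a ∈ VB, ∃ c : ℝ, (c = 1 ∨ c = -1) ∧ ∀ x, AB (bxor x a) = c * AB x := by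
    intro a ha
    refine ⟨((eB (bxor xB a) * eB xB : ℤ) : ℝ), ?_, fun x => ?_⟩
    · rcases heB _ (hPVB _ hxB _ ha) with h1 | h1 <;> rcases heB _ hxB with h2 | h2 <;> rw [h1, h2] <;> norm_num
    · by_cases hx : x ∈ B
      · have hxa : bxor x a ∈ B := hPVB x hx a ha
        simp only [AB, if_pos hx, if_pos hxa]
        have hb : bxor xB x ∈ VB := fl1_coset_diff hSB hx
        have hm := hmul xB hxB a ha (bxor xB x) hb
        rw [bxor_bxor_cancel_left] at hm
        have hsq : eB xB * eB xB = 1 := by rcases heB _ hxB with h1 | h1 <;> rw [h1] <;> norm_num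
        have : eB (bxor x a) = eB (bxor xB a) * eB xB * eB x := by
          have h' : eB (bxor x a) * eB xB * eB xB = eB (bxor xB a) * eB x * eB xB := by rw [hm]
          rw [mul_assoc, hsq, mul_one] at h'
          rw [h']; ring
        rw [this]; push_cast; ring
      · have hxa : bxor x a ∉ B := fl1_coset_out' haddB hSB hx ha
        simp only [AB, if_neg hx, if_neg hxa, mul_zero]
  have hBb := fp_l1_sq_mul_le AB B VB (fun x hx => by
      simp only [AB, if_pos hx]; rcases heB x hx with h1 | h1 <;> rw [h1] <;> norm_num) (fun x hx => by simp only [AB, if_neg hx])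
    h0B haddB hperB
  rw [hcardVB, hBc] at hBb
  have hN : (2 : ℝ) ^ ((3 * (k + 3) + 2) + (3 * (k + 3) + 2)) = 2 ^ (6 * k + 22) := by ring
  have hYle : ∑ y, |W AB y| ≤ (2 : ℝ) ^ (6 * k + 22) := by
    have hnn : 0 ≤ ∑ y, |W AB y| := sum_nonneg fun y _ => abs_nonneg _
    have hposB : (0 : ℝ) < ((2 ^ (6 * k + 17) : ℕ) : ℝ) := by positivity
    rw [hN] at hBb
    have h3 : (∑ y, |W AB y|) ^ 2 * ((2 ^ (6 * k + 17) : ℕ) : ℝ) ≤ ((2 : ℝ) ^ (6 * k + 22)) ^ 2 * ((2 ^ (6 * k + 17) : ℕ) : ℝ) :=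
      hBb.trans_eq (by ring)
    exact (pow_le_pow_iff_left₀ hnn (by positivity) two_ne_zero).1 (le_of_mul_le_mul_right h3 hposB)
  -- the `L`-piece
  have hqH : ∀ a ∈ VL, ∀ h, decide (Odd (u h)) = false → decide (Odd (u (bxor h a) / 2)) = decide (Odd (u h / 2)) := by
    intro a ha h hh
    have hh' : ¬ Odd (u h) := by simpa using hh
    have hha : ¬ Odd (u (bxor h a)) := hH_of h hh' a ha
    rw [decide_eq_false (hA h hh'), decide_eq_false (hA _ hha)]
  obtain ⟨xH, hxH⟩ := heven
  have hxH' : decide (Odd (u xH)) = false := decide_eq_false hxH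
  set AL : (Fin ((3 * (k + 3) + 2) + (3 * (k + 3) + 2)) → Bool) → ℝ :=
    fun x => if decide (Odd (u x)) = true then signOf (decide (Odd (u x / 2))) else 0 with hAL
  have hL := sp_L_l1 (fun x => decide (Odd (u x))) (fun x => decide (Odd (u x / 2))) hd0 hd1 VL h0L haddL hperL hqH hxH'
  rw [hcardVL, hfiltL, hLc, hN] at hL
  have hXle : ∑ y, |W AL y| ≤ (2 : ℝ) ^ (6 * k + 22) := by
    have hnn : 0 ≤ ∑ y, |W AL y| := sum_nonneg fun y _ => abs_nonneg _
    have hposL : (0 : ℝ) < ((2 ^ (6 * (k + 3) + 3) : ℕ) : ℝ) := by positivity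
    have h3 : (∑ y, |W AL y|) ^ 2 * ((2 ^ (6 * (k + 3) + 3) : ℕ) : ℝ) ≤ ((2 : ℝ) ^ (6 * k + 22)) ^ 2 * ((2 ^ (6 * (k + 3) + 3) : ℕ) : ℝ) :=
      hL.trans_eq (by ring)
    exact (pow_le_pow_iff_left₀ hnn (by positivity) two_ne_zero).1 (le_of_mul_le_mul_right h3 hposL)
  -- decomposition of the residual
  have hdecomp : (fun x => (u x : ℝ) - (2 : ℝ) ^ (k + 3) * signOf (f x)) = fun x => AL x + 4 * AB x := by
    funext x
    have e : (u x : ℝ) - (2 : ℝ) ^ (k + 3) * signOf (f x) = (((u x - 2 ^ (k + 3) * sZ (f x) : ℤ)) : ℝ) := by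
      push_cast; rw [tp_sZ_cast]
    rw [e]
    by_cases hx : Odd (u x)
    · have hxB' : x ∉ B := fun h => ((hmemB x).1 h).1 hx
      simp only [AL, AB, if_pos (decide_eq_true hx), if_neg hxB']
      rw [hτL x hx, tp_sZ_cast]; ring
    · have hdx : ¬ decide (Odd (u x)) = true := by simpa using hx
      by_cases hxB' : x ∈ B
      · simp only [AL, AB, if_neg hdx, if_pos hxB']
        rw [hFe x hxB']; push_cast; ring
      · simp only [AL, AB, if_neg hdx, if_neg hxB']
        rw [hτ0 x hx hxB']; norm_num
  -- pairing
  have hpair := fms_pairing (k + 3) f g u hu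
  rw [hdecomp] at hpair
  have e2 : ∀ y, signOf (g y) * W (fun x => AL x + 4 * AB x) y =
      signOf (g y) * W AL y + 4 * (signOf (g y) * W AB y) := fun y => by
    rw [sp_W_add, fl1_W_smul]; ring
  rw [sum_congr rfl fun y _ => e2 y, sum_add_distrib, ← mul_sum,
    show (2 : ℝ) ^ (10 * (k + 3) + 6) = 2 ^ (2 * k + 7) * 2 ^ (8 * (k + 3) + 5) by ring, mul_assoc, hTeq] at hpair
  have hPL : ∑ y, signOf (g y) * W AL y ≤ ∑ y, |W AL y| := fl1_pairing_le_l1 g (W AL)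
  have hPB : ∑ y, signOf (g y) * W AB y ≤ ∑ y, |W AB y| := fl1_pairing_le_l1 g (W AB)
  have hbig : (8 : ℝ) * 2 ^ (6 * k + 22) ≤ 2 ^ (2 * k + 7) * 2 ^ (6 * (k + 3) + 4) := by
    have e8 : (2 : ℝ) ^ (2 * k + 7) * 2 ^ (6 * (k + 3) + 4) = 2 ^ (2 * k + 4) * (8 * 2 ^ (6 * k + 22)) := by ring
    rw [e8]
    have h1 : (1 : ℝ) ≤ 2 ^ (2 * k + 4) := one_le_pow₀ (by norm_num)
    have h2 : (0 : ℝ) ≤ 8 * 2 ^ (6 * k + 22) := by positivity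
    exact le_mul_of_one_le_left h2 h1
  have hpos : (0 : ℝ) < 2 ^ (6 * k + 22) := by positivity
  linarith

end Summit.QuantumAdvantage.QuantumAdvantage.Theorems.CubicForrelation.NearExactIsExact

end
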